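import Summits.MatrixMultiplication.MatrixMultiplication.Theorems.FarEdgeDescentDefectDial
import HarnessLib

/-!
# Route `FarEdgeDescent` — the SUMMABLE ENDPOINT of the defect dial: an exponential floor under a
doubling defect whose logarithm is dyadically summable, and the exact cuts
`ω = 2 ⟺ SuperExpContact ∧ SummableLogDefect ⟺ FiniteSaturation ∧ SummableLogDefect` — all PROVED

decomp-mm ROOT cell (D-0178), lens 2 «structural dichotomy: special vs generic», gen 19.  Notation:
`e(x) := ω(1,x,1) − (x+1) ≥ 0` (excess on the real shape axis `⟨n,n^x,n⟩`), `w := e(1) = ω − 2`,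
`s := 3 − ω ≥ 0`.  The dial of the generic leaf so far (landed `FarEdgeDescentExpFloor`, `FarEdgeDescentDefectDial`):
`AnchoredLogConvexity` (`e(m)² ≤ w·e(2m−1)`, stmt-28900) ⟹ `BoundedDoublingDefect` = BDD (`∃ C, e(m)² ≤
C·w·e(2m−1)`, stmt-26556) ⟹ the bare residual of the special leaf `SuperExpContact` (stmt-28901), an
exponential-floor law with free constants (`residual_iff_expFloorLaw`).  This file turns the dial to the last
notch the halving mechanism can read, the aside `SummableLogDefect` = SLD (stmt-27344, route rev 11): a dyadic
ENVELOPE `C : ℕ → ℝ`, `C_i ≥ 1`, with `e(m)² ≤ C_i·w·e(2m−1)` for all shapes `1 < m ≤ 2^i + 1` and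
`Σ_i log(C_i)/2^i < ∞` (BDD is the constant envelope; SLD lets the defect GROW with the scale — any growth
whose logarithm is summable against `dm/m²`: polynomial, `exp(m^θ)` with `θ < 1`, …).
* §0 **ENGINE (abstract, PROVED).**  For a real profile `E` with the envelope law and the supporting line
  `E(m) ≥ w − s(m−1)`: along the halving orbit `m_j = 1 + (K−1)/2^j` the law with scale-dependent defects
  `D_j` gives the PRODUCT FORM `w·(E(m_J)/w)^(2^J) ≤ E(K)·∏_{j<J} D_j^(2^j)` (`orbit_budget`); stopped at
  depth `2^J ∈ [2a, 4a+2]`, `a = (s/w)(K−1)`, where the line still gives `E(m_J) ≥ w/2` (`stopped_orbit`),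
  the price is the BUDGET `Σ_{j<J} 2^j·log D_j ≤ (2^N/2)·Σ_{i<N} log(C_i)/2^i + 2^J·log C_0` (`K−1 ≤ 2^N ≤ 2K`;
  the orbit point at depth `j+1` lies in the window of level `N−1−j`; `level_budget`) — LINEAR in `K`
  exactly when the dyadic series is summable; result `E(K) ≥ w·exp(−[(4a+2)·log(2C_0) + B·K])`
  (`exp_floor_summable`, `B` = any bound of the partial sums).
* §1 **AT THE TRUE EXPONENTS (PROVED).**  `SLD ∧ ω > 2 ⟹` the exponential floor (`expFloor_of_sld`) and a
  geometric floor `e(k) ≥ ρ^k` at every `k ≥ 1` (`geometric_floor_of_sld`).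
* §2 **BY NAME over the route items (PROVED).**  `closes_sldSec : SuperExpContact → SummableLogDefect → ω = 2`
  (cut B‴ — the same statement as the certified, banked re-glue `glue19.lean`), `closes_sldFs :
  FiniteSaturation → SummableLogDefect → ω = 2` (cut A‴), exactness `node_sldSec_iff`, `node_sldFs_iff`,
  necessity `sld_of_mm`, the notches `sld_of_bdd`, `sld_of_alc`, and the four-notch dial `dial_chain₄`.
  Strictness of the new inclusions and the failure of the NEXT candidate notch (linear log-defect) are the
  companion file `FarEdgeDescentSummableWorlds` (model profiles).

Imports only the BUILT module `FarEdgeDescentDefectDial`; no definitions; restates nothing (re-uses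
`anchorLine_le_excess`, `geom_le_expProfile`, `bdd_mono`, `bdd_of_alc`, `bdd_of_mm`, `anchored_of_realLogConvexity`).
[cite: LottiRomani1983, §1 (p. 173), §2 (p. 174)] [cite: Coppersmith1982] [cite: HuangPan1998, §8]
-/

set_option linter.dupNamespace false

noncomputable section

namespace Summit.MatrixMultiplication.MatrixMultiplication.Theorems.FarEdgeDescentSummableDefect

open Literature.Computability.AlgebraicComplexity
open Summit.MatrixMultiplication.MatrixMultiplication.Theses.FarEdgeDescent
open Summit.MatrixMultiplication.MatrixMultiplication.Theorems.FarEdgeDescentChord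
open Summit.MatrixMultiplication.MatrixMultiplication.Theorems.FarEdgeDescentExpFloor
open Summit.MatrixMultiplication.MatrixMultiplication.Theorems.FarEdgeDescentDefectDial
open Finset

/-! ## §0 The abstract engine: orbit with budget, stopped orbit, dyadic budget -/

/-- **Orbit with budget (product form).**  If along the halving orbit `m_j = 1 + (K−1)/2^j` of a shape `K`
the profile obeys `E(m_{j+1})² ≤ D_j·w·E(m_j)` with scale-dependent defects `D_j ≥ 0` (`w > 0`), then
`w·(E(m_J)/w)^(2^J) ≤ E(K)·∏_{j<J} D_j^(2^j)` for every depth `J`. -/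
theorem orbit_budget {E : ℝ → ℝ} {w K : ℝ} {D : ℕ → ℝ} (hw : 0 < w) (hD : ∀ j, 0 ≤ D j)
    (hA : ∀ j : ℕ, E (1 + (K - 1) / 2 ^ (j + 1)) ^ 2 ≤ D j * w * E (1 + (K - 1) / 2 ^ j)) (J : ℕ) :
    w * (E (1 + (K - 1) / 2 ^ J) / w) ^ 2 ^ J ≤ E K * ∏ j ∈ range J, D j ^ 2 ^ j := by
  induction J with
  | zero =>
    have e : 1 + (K - 1) / 2 ^ 0 = K := by rw [pow_zero, div_one]; ring
    rw [e, prod_range_zero, mul_one, pow_zero, pow_one, mul_div_cancel₀ _ hw.ne']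
  | succ J ih =>
    have hAP := hA J
    have hsq : (E (1 + (K - 1) / 2 ^ (J + 1)) / w) ^ 2 ≤ D J * (E (1 + (K - 1) / 2 ^ J) / w) := by
      have h1 : (E (1 + (K - 1) / 2 ^ (J + 1)) / w) ^ 2 = E (1 + (K - 1) / 2 ^ (J + 1)) ^ 2 / w ^ 2 :=
        div_pow _ _ _
      have h2 : D J * (E (1 + (K - 1) / 2 ^ J) / w) = D J * w * E (1 + (K - 1) / 2 ^ J) / w ^ 2 := by
        field_simp
      rw [h1, h2]
      exact div_le_div_of_nonneg_right hAP (sq_nonneg w)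
    have hpow : (E (1 + (K - 1) / 2 ^ (J + 1)) / w) ^ 2 ^ (J + 1) ≤
        D J ^ 2 ^ J * (E (1 + (K - 1) / 2 ^ J) / w) ^ 2 ^ J := by
      have e : (2 : ℕ) ^ (J + 1) = 2 * 2 ^ J := pow_succ' 2 J
      rw [e, pow_mul, ← mul_pow]
      exact pow_le_pow_left₀ (sq_nonneg _) hsq _
    calc w * (E (1 + (K - 1) / 2 ^ (J + 1)) / w) ^ 2 ^ (J + 1)
        ≤ w * (D J ^ 2 ^ J * (E (1 + (K - 1) / 2 ^ J) / w) ^ 2 ^ J) :=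
          mul_le_mul_of_nonneg_left hpow hw.le
      _ = D J ^ 2 ^ J * (w * (E (1 + (K - 1) / 2 ^ J) / w) ^ 2 ^ J) := by ring
      _ ≤ D J ^ 2 ^ J * (E K * ∏ j ∈ range J, D j ^ 2 ^ j) :=
          mul_le_mul_of_nonneg_left ih (pow_nonneg (hD J) _)
      _ = E K * ∏ j ∈ range (J + 1), D j ^ 2 ^ j := by rw [prod_range_succ]; ring

/-- **Stopped orbit.**  With also the supporting line `E(m) ≥ w − s(m−1)` on `[1,∞)` (`s ≥ 0`) there is a
depth `J`, `2a ≤ 2^J ≤ 4a + 2`, `a := (s/w)(K−1)`, with `w·exp(−(4a+2)·log 2) ≤ E(K)·∏_{j<J} D_j^(2^j)`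
(the line still gives `E(m_J) ≥ w/2` there). -/
theorem stopped_orbit {E : ℝ → ℝ} {w s K : ℝ} {D : ℕ → ℝ} (hw : 0 < w) (hs : 0 ≤ s) (hK : 1 < K)
    (hD : ∀ j, 0 ≤ D j) (hlin : ∀ m : ℝ, 1 ≤ m → w - s * (m - 1) ≤ E m)
    (hA : ∀ j : ℕ, E (1 + (K - 1) / 2 ^ (j + 1)) ^ 2 ≤ D j * w * E (1 + (K - 1) / 2 ^ j)) :
    ∃ J : ℕ, (2 : ℝ) ^ J ≤ 4 * (s / w * (K - 1)) + 2 ∧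
      w * Real.exp (-((4 * (s / w * (K - 1)) + 2) * Real.log 2)) ≤ E K * ∏ j ∈ range J, D j ^ 2 ^ j := by
  set a : ℝ := s / w * (K - 1) with ha
  have ha0 : 0 ≤ a := mul_nonneg (div_nonneg hs hw.le) (by linarith)
  have hwne : w ≠ 0 := hw.ne'
  have hx1 : (1 : ℝ) ≤ max (2 * a) 1 := le_max_right _ _
  obtain ⟨n, hn, hn'⟩ := exists_nat_pow_near hx1 (by norm_num : (1 : ℝ) < 2)
  have h2a : 2 * a ≤ (2 : ℝ) ^ (n + 1) := (le_max_left _ _).trans hn'.le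
  have hjle : (2 : ℝ) ^ (n + 1) ≤ 4 * a + 2 := by
    have hmax : max (2 * a) 1 ≤ 2 * a + 1 := max_le (by linarith) (by linarith)
    rw [pow_succ]
    nlinarith [hn, hmax]
  refine ⟨n + 1, hjle, ?_⟩
  have h2j : (0 : ℝ) < 2 ^ (n + 1) := pow_pos two_pos _
  have hm1 : 1 ≤ 1 + (K - 1) / 2 ^ (n + 1) := by
    have := div_pos (sub_pos.2 hK) h2j
    linarith
  have hline := hlin (1 + (K - 1) / 2 ^ (n + 1)) hm1
  have hsK : s * (K - 1) = w * a := by rw [ha]; field_simp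
  have hhalf : w / 2 ≤ E (1 + (K - 1) / 2 ^ (n + 1)) := by
    have e1 : s * (1 + (K - 1) / 2 ^ (n + 1) - 1) = w * a / 2 ^ (n + 1) := by
      rw [← hsK]; ring
    have e2 : w * a / 2 ^ (n + 1) ≤ w / 2 := by
      rw [div_le_div_iff₀ h2j two_pos]
      nlinarith [h2a, hw]
    linarith [e1, e2, hline]
  have hbase : 1 / 2 ≤ E (1 + (K - 1) / 2 ^ (n + 1)) / w := by
    rw [le_div_iff₀ hw]; linarith
  have hpow : (1 / 2 : ℝ) ^ 2 ^ (n + 1) ≤ (E (1 + (K - 1) / 2 ^ (n + 1)) / w) ^ 2 ^ (n + 1) :=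
    pow_le_pow_left₀ (by norm_num) hbase _
  have hb : (1 : ℝ) / 2 = Real.exp (-Real.log 2) := by
    rw [Real.exp_neg, Real.exp_log two_pos, one_div]
  have hbexp : (1 / 2 : ℝ) ^ 2 ^ (n + 1) = Real.exp (-((2 : ℝ) ^ (n + 1) * Real.log 2)) := by
    rw [hb, ← Real.exp_nat_mul]
    congr 1
    push_cast
    ring
  have hexp_ge : Real.exp (-((4 * a + 2) * Real.log 2)) ≤ Real.exp (-((2 : ℝ) ^ (n + 1) * Real.log 2)) := by
    rw [Real.exp_le_exp]
    have := mul_le_mul_of_nonneg_right hjle (Real.log_nonneg one_le_two)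
    linarith
  calc w * Real.exp (-((4 * a + 2) * Real.log 2))
      ≤ w * Real.exp (-((2 : ℝ) ^ (n + 1) * Real.log 2)) := mul_le_mul_of_nonneg_left hexp_ge hw.le
    _ = w * (1 / 2 : ℝ) ^ 2 ^ (n + 1) := by rw [hbexp]
    _ ≤ w * (E (1 + (K - 1) / 2 ^ (n + 1)) / w) ^ 2 ^ (n + 1) := mul_le_mul_of_nonneg_left hpow hw.le
    _ ≤ E K * ∏ j ∈ range (n + 1), D j ^ 2 ^ j := orbit_budget hw hD hA (n + 1)

/-- **Dyadic budget.**  For an envelope `C_i ≥ 1` with partial sums `Σ_{i<n} log(C_i)/2^i ≤ B` and defects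
read off by levels, `D_j := C_{N−(j+1)}` (truncated subtraction: deep levels read `C_0`):
`Σ_{j<J} 2^j·log D_j ≤ (2^N/2)·B + 2^J·log C_0` (reflect the first `N` terms, bound the rest by `C_0`). -/
theorem level_budget {C : ℕ → ℝ} {B : ℝ} (hC : ∀ i, 1 ≤ C i)
    (hB : ∀ n, ∑ i ∈ range n, Real.log (C i) / 2 ^ i ≤ B) (N J : ℕ) :
    ∑ j ∈ range J, (2 : ℝ) ^ j * Real.log (C (N - (j + 1))) ≤
      2 ^ N / 2 * B + 2 ^ J * Real.log (C 0) := by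
  have hlog0 : ∀ i, 0 ≤ Real.log (C i) := fun i => Real.log_nonneg (hC i)
  have key : ∀ j ∈ range J, (2 : ℝ) ^ j * Real.log (C (N - (j + 1))) ≤
      (if j < N then (2 : ℝ) ^ N / 2 * (Real.log (C (N - 1 - j)) / 2 ^ (N - 1 - j)) else 0) +
        2 ^ j * Real.log (C 0) := by
    intro j _
    split_ifs with h
    · have e1 : N - (j + 1) = N - 1 - j := by omega
      have e2 : (2 : ℝ) ^ N / 2 * (Real.log (C (N - 1 - j)) / 2 ^ (N - 1 - j)) =
          2 ^ j * Real.log (C (N - 1 - j)) := by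
        have e3 : (2 : ℝ) ^ N = 2 * 2 ^ j * 2 ^ (N - 1 - j) := by
          rw [← pow_succ', ← pow_add]
          congr 1
          omega
        rw [e3]
        field_simp
      rw [e1, e2]
      linarith [mul_nonneg (pow_nonneg (zero_le_two : (0 : ℝ) ≤ 2) j) (hlog0 0)]
    · have e1 : N - (j + 1) = 0 := by omega
      rw [e1, zero_add]
  have h1 : ∑ j ∈ range J,
      (if j < N then (2 : ℝ) ^ N / 2 * (Real.log (C (N - 1 - j)) / 2 ^ (N - 1 - j)) else 0) ≤
        2 ^ N / 2 * B := by
    rw [← sum_filter]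
    have hsub : (range J).filter (fun j => j < N) ⊆ range N := by
      intro j hj
      rw [mem_filter] at hj
      exact mem_range.2 hj.2
    have hnn : ∀ j ∈ range N, j ∉ (range J).filter (fun j => j < N) →
        0 ≤ (2 : ℝ) ^ N / 2 * (Real.log (C (N - 1 - j)) / 2 ^ (N - 1 - j)) :=
      fun j _ _ => by positivity [hlog0 (N - 1 - j)]
    refine (sum_le_sum_of_subset_of_nonneg hsub hnn).trans ?_
    rw [← mul_sum, sum_range_reflect (fun i => Real.log (C i) / 2 ^ i) N]
    exact mul_le_mul_of_nonneg_left (hB N) (by positivity)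
  have h2 : ∑ j ∈ range J, (2 : ℝ) ^ j * Real.log (C 0) ≤ 2 ^ J * Real.log (C 0) := by
    rw [← sum_mul, geom_sum_eq (by norm_num : (2 : ℝ) ≠ 1)]
    apply mul_le_mul_of_nonneg_right _ (hlog0 0)
    norm_num
  calc ∑ j ∈ range J, (2 : ℝ) ^ j * Real.log (C (N - (j + 1)))
      ≤ ∑ j ∈ range J, ((if j < N then (2 : ℝ) ^ N / 2 * (Real.log (C (N - 1 - j)) / 2 ^ (N - 1 - j))
          else 0) + 2 ^ j * Real.log (C 0)) := sum_le_sum key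
    _ = (∑ j ∈ range J,
          (if j < N then (2 : ℝ) ^ N / 2 * (Real.log (C (N - 1 - j)) / 2 ^ (N - 1 - j)) else 0)) +
          ∑ j ∈ range J, (2 : ℝ) ^ j * Real.log (C 0) := sum_add_distrib
    _ ≤ 2 ^ N / 2 * B + 2 ^ J * Real.log (C 0) := add_le_add h1 h2

/-- **Exponential floor under a summable log-defect (abstract, PROVED).**  A profile `E` on `[1,∞)` with the
line `E(m) ≥ w − s(m−1)` (`w > 0`, `s ≥ 0`) and the ENVELOPE law `E(m)² ≤ C_i·w·E(2m−1)` for `1 < m ≤ 2^i + 1`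
(`C_i ≥ 1`, `Σ_{i<n} log(C_i)/2^i ≤ B`) has `E(K) ≥ w·exp(−[(4(s/w)(K−1) + 2)·log(2·C_0) + B·K])` for
every `K > 1` — the rate is finite BECAUSE the dyadic series converges. -/
theorem exp_floor_summable {E : ℝ → ℝ} {w s B : ℝ} {C : ℕ → ℝ} (hw : 0 < w) (hs : 0 ≤ s)
    (hC : ∀ i, 1 ≤ C i) (hB : ∀ n, ∑ i ∈ range n, Real.log (C i) / 2 ^ i ≤ B)
    (hlin : ∀ m : ℝ, 1 ≤ m → w - s * (m - 1) ≤ E m)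
    (hA : ∀ (i : ℕ) (m : ℝ), 1 < m → m ≤ 2 ^ i + 1 → E m ^ 2 ≤ C i * w * E (2 * m - 1))
    {K : ℝ} (hK : 1 < K) :
    w * Real.exp (-((4 * (s / w * (K - 1)) + 2) * Real.log (2 * C 0) + B * K)) ≤ E K := by
  -- the dyadic scale `N = n+1` of `K`: `K − 1 ≤ 2^N ≤ 2K`
  have hx1 : (1 : ℝ) ≤ max (K - 1) 1 := le_max_right _ _
  obtain ⟨n, hn, hn'⟩ := exists_nat_pow_near hx1 (by norm_num : (1 : ℝ) < 2)
  have hKN : K - 1 ≤ (2 : ℝ) ^ (n + 1) := (le_max_left _ _).trans hn'.le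
  have hNK : (2 : ℝ) ^ (n + 1) ≤ 2 * K := by
    have hmax : max (K - 1) 1 ≤ K := max_le (by linarith) hK.le
    rw [pow_succ]
    nlinarith [hn, hmax]
  -- defects read off the envelope by levels
  set D : ℕ → ℝ := fun j => C (n + 1 - (j + 1)) with hD
  have hDpos : ∀ j, 0 < D j := fun j => by simp only [hD]; linarith [hC (n + 1 - (j + 1))]
  have hD0 : ∀ j, 0 ≤ D j := fun j => (hDpos j).le
  have hAD : ∀ j : ℕ, E (1 + (K - 1) / 2 ^ (j + 1)) ^ 2 ≤ D j * w * E (1 + (K - 1) / 2 ^ j) := by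
    intro j
    have h2j : (0 : ℝ) < 2 ^ (j + 1) := pow_pos two_pos _
    have hm : 1 < 1 + (K - 1) / 2 ^ (j + 1) := by
      have := div_pos (sub_pos.2 hK) h2j
      linarith
    have hlev : 1 + (K - 1) / 2 ^ (j + 1) ≤ (2 : ℝ) ^ (n + 1 - (j + 1)) + 1 := by
      have hq : (K - 1) / 2 ^ (j + 1) ≤ (2 : ℝ) ^ (n + 1 - (j + 1)) := by
        rw [div_le_iff₀ h2j, ← pow_add]
        exact hKN.trans (pow_le_pow_right₀ one_le_two (by omega))
      linarith
    have h := hA (n + 1 - (j + 1)) _ hm hlev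
    have e1 : 2 * (1 + (K - 1) / 2 ^ (j + 1)) - 1 = 1 + (K - 1) / 2 ^ j := by
      rw [pow_succ]; field_simp; ring
    rw [e1] at h
    exact h
  obtain ⟨J, hJ, hfloor⟩ := stopped_orbit hw hs hK hD0 hlin hAD
  -- the price: the logarithm of the product is the dyadic budget
  have hP : 0 < ∏ j ∈ range J, D j ^ 2 ^ j := prod_pos fun j _ => pow_pos (hDpos j) _
  have hlogP : Real.log (∏ j ∈ range J, D j ^ 2 ^ j) = ∑ j ∈ range J, (2 : ℝ) ^ j * Real.log (D j) := by
    rw [Real.log_prod (fun j _ => (pow_pos (hDpos j) _).ne')]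
    refine sum_congr rfl fun j _ => ?_
    rw [Real.log_pow]
    push_cast
    ring
  have hB0 : 0 ≤ B := by simpa using hB 0
  have hbud : ∑ j ∈ range J, (2 : ℝ) ^ j * Real.log (D j) ≤
      2 ^ (n + 1) / 2 * B + 2 ^ J * Real.log (C 0) := level_budget hC hB (n + 1) J
  have hlogP_le : Real.log (∏ j ∈ range J, D j ^ 2 ^ j) ≤
      B * K + (4 * (s / w * (K - 1)) + 2) * Real.log (C 0) := by
    rw [hlogP]
    have h1 : (2 : ℝ) ^ (n + 1) / 2 * B ≤ B * K := by nlinarith [hNK, hB0]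
    have h2 : (2 : ℝ) ^ J * Real.log (C 0) ≤ (4 * (s / w * (K - 1)) + 2) * Real.log (C 0) :=
      mul_le_mul_of_nonneg_right hJ (Real.log_nonneg (hC 0))
    linarith [hbud]
  have hEK : w * Real.exp (-((4 * (s / w * (K - 1)) + 2) * Real.log 2)) /
      (∏ j ∈ range J, D j ^ 2 ^ j) ≤ E K := by
    rw [div_le_iff₀ hP]; exact hfloor
  have hC0 : 0 < C 0 := by linarith [hC 0]
  have esplit : Real.exp (-((4 * (s / w * (K - 1)) + 2) * Real.log (2 * C 0) + B * K)) =
      Real.exp (-((4 * (s / w * (K - 1)) + 2) * Real.log 2)) *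
        Real.exp (-(B * K + (4 * (s / w * (K - 1)) + 2) * Real.log (C 0))) := by
    rw [← Real.exp_add, Real.log_mul two_ne_zero hC0.ne']
    congr 1
    ring
  calc w * Real.exp (-((4 * (s / w * (K - 1)) + 2) * Real.log (2 * C 0) + B * K))
      = w * Real.exp (-((4 * (s / w * (K - 1)) + 2) * Real.log 2)) *
          Real.exp (-(B * K + (4 * (s / w * (K - 1)) + 2) * Real.log (C 0))) := by
        rw [esplit, mul_assoc]
    _ ≤ w * Real.exp (-((4 * (s / w * (K - 1)) + 2) * Real.log 2)) *
          Real.exp (-Real.log (∏ j ∈ range J, D j ^ 2 ^ j)) := by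
        apply mul_le_mul_of_nonneg_left _ (by positivity)
        rw [Real.exp_le_exp]
        linarith [hlogP_le]
    _ = w * Real.exp (-((4 * (s / w * (K - 1)) + 2) * Real.log 2)) / (∏ j ∈ range J, D j ^ 2 ^ j) := by
        rw [Real.exp_neg (Real.log _), Real.exp_log hP]
        simp only [div_eq_mul_inv]
    _ ≤ E K := hEK

/-! ## §1 The floor under a summable log-defect, at the true exponents -/

/-- **EXPONENTIAL FLOOR under SLD (PROVED).**  A dyadic envelope `C_i ≥ 1` of the true doubling defect with
`Σ_{i<n} log(C_i)/2^i ≤ B` and `ω > 2` give `e(K) ≥ (ω−2)·exp(−[(4·((3−ω)/(ω−2))·(K−1) + 2)·log(2C_0) + B·K])`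
for every real `K > 1` (anchor line = Lotti–Romani convexity, `anchorLine_le_excess`). -/
theorem expFloor_of_sld {C : ℕ → ℝ} {B : ℝ} (hC : ∀ i, 1 ≤ C i)
    (hB : ∀ n, ∑ i ∈ range n, Real.log (C i) / 2 ^ i ≤ B)
    (hL : ∀ (i : ℕ) (m : ℝ), 1 < m → m ≤ 2 ^ i + 1 → (omegaRect ℂ 1 m 1 - (m + 1)) ^ 2 ≤
      C i * (omegaRect ℂ 1 1 1 - 2) * (omegaRect ℂ 1 (2 * m - 1) 1 - 2 * m))
    (hω : 2 < omega ℂ) {K : ℝ} (hK : 1 < K) :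
    (omega ℂ - 2) * Real.exp (-((4 * ((3 - omega ℂ) / (omega ℂ - 2) * (K - 1)) + 2) *
        Real.log (2 * C 0) + B * K)) ≤ omegaRect ℂ 1 K 1 - (K + 1) := by
  have hw : 0 < omega ℂ - 2 := sub_pos.2 hω
  refine exp_floor_summable (E := fun m => omegaRect ℂ 1 m 1 - (m + 1)) hw
    (by linarith [omega_le_three' (K := ℂ)]) hC hB (fun m hm => anchorLine_le_excess hm)
    (fun i m hm hmi => ?_) hK
  have h := hL i m hm hmi
  rw [omegaRect_one_one_one] at h
  have e : (2 : ℝ) * m - 1 + 1 = 2 * m := by ring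
  show (omegaRect ℂ 1 m 1 - (m + 1)) ^ 2 ≤
    C i * (omega ℂ - 2) * (omegaRect ℂ 1 (2 * m - 1) 1 - (2 * m - 1 + 1))
  rw [e]; exact h

/-- **GEOMETRIC FLOOR under SLD (PROVED).**  With a summable dyadic envelope (`Summable` form) and `ω > 2`:
`∃ ρ > 0, e(k) ≥ ρ^k` at EVERY integer `k ≥ 1` — `liminf e(k)^{1/k} > 0`. -/
theorem geometric_floor_of_sld {C : ℕ → ℝ} (hC : ∀ i, 1 ≤ C i)
    (hS : Summable (fun i : ℕ => Real.log (C i) / 2 ^ i))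
    (hL : ∀ (i : ℕ) (m : ℝ), 1 < m → m ≤ 2 ^ i + 1 → (omegaRect ℂ 1 m 1 - (m + 1)) ^ 2 ≤
      C i * (omegaRect ℂ 1 1 1 - 2) * (omegaRect ℂ 1 (2 * m - 1) 1 - 2 * m))
    (hω : 2 < omega ℂ) :
    ∃ ρ : ℝ, 0 < ρ ∧ ∀ k : ℕ, 1 ≤ k → ρ ^ k ≤ omegaRect ℂ 1 k 1 - (k + 1) := by
  set B : ℝ := ∑' i, Real.log (C i) / 2 ^ i with hBdef
  have hB : ∀ n, ∑ i ∈ range n, Real.log (C i) / 2 ^ i ≤ B := fun n =>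
    hS.sum_le_tsum (range n) fun i _ => div_nonneg (Real.log_nonneg (hC i)) (pow_pos two_pos i).le
  have hB0 : 0 ≤ B := by simpa using hB 0
  have hw : 0 < omega ℂ - 2 := sub_pos.2 hω
  have hlog2C : 0 ≤ Real.log (2 * C 0) := Real.log_nonneg (by linarith [hC 0])
  have hfrac : 0 ≤ (3 - omega ℂ) / (omega ℂ - 2) :=
    div_nonneg (by linarith [omega_le_three' (K := ℂ)]) hw.le
  set L : ℝ := 4 * ((3 - omega ℂ) / (omega ℂ - 2)) * Real.log (2 * C 0) + B with hLdef
  set c : ℝ := (omega ℂ - 2) * Real.exp (-(2 * Real.log (2 * C 0) + B)) with hcdef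
  have hL0 : 0 ≤ L := add_nonneg (mul_nonneg (mul_nonneg (by norm_num) hfrac) hlog2C) hB0
  have hc0 : 0 < c := mul_pos hw (Real.exp_pos _)
  refine ⟨Real.exp (-L) * min 1 c, mul_pos (Real.exp_pos _) (lt_min one_pos hc0), fun k hk => ?_⟩
  refine (geom_le_expProfile hc0 hL0 (k := k) hk).trans ?_
  rcases Nat.lt_or_ge 1 k with hk1 | hk1
  · have hk1' : (1 : ℝ) < k := by exact_mod_cast hk1
    have hfloor := expFloor_of_sld hC hB hL hω hk1'
    have e : c * Real.exp (-(L * ((k : ℝ) - 1))) = (omega ℂ - 2) *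
        Real.exp (-((4 * ((3 - omega ℂ) / (omega ℂ - 2) * ((k : ℝ) - 1)) + 2) *
          Real.log (2 * C 0) + B * k)) := by
      rw [hcdef, hLdef, mul_assoc, ← Real.exp_add]; congr 2; ring
    rw [e]; exact hfloor
  · have hk_eq : k = 1 := le_antisymm hk1 hk
    subst hk_eq
    push_cast
    rw [sub_self, mul_zero, neg_zero, Real.exp_zero, mul_one, omegaRect_one_one_one, hcdef]
    have h1 : Real.exp (-(2 * Real.log (2 * C 0) + B)) ≤ 1 := Real.exp_le_one_iff.2 (by linarith)
    nlinarith [h1, hw, Real.exp_pos (-(2 * Real.log (2 * C 0) + B))]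

/-! ## §2 The aside `SummableLogDefect` (stmt-MatrixMultiplication-27344, route rev 11): exact cuts,
necessity, and the dial — by name -/

/-- The aside of record IS the summable log-defect law `SLD` of the header (definitional unfolding). -/
theorem summableLogDefect_iff : SummableLogDefect ↔
    ∃ C : ℕ → ℝ, (∀ i, 1 ≤ C i) ∧ Summable (fun i : ℕ => Real.log (C i) / 2 ^ i) ∧
      ∀ (i : ℕ) (m : ℝ), 1 < m → m ≤ 2 ^ i + 1 → (omegaRect ℂ 1 m 1 - (m + 1)) ^ 2 ≤
        C i * (omegaRect ℂ 1 1 1 - 2) * (omegaRect ℂ 1 (2 * m - 1) 1 - 2 * m) :=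
  Iff.rfl

/-- **DECIDING THEOREM, contact form — cut B‴ (PROVED).**  `SuperExpContact → SummableLogDefect → ω(ℂ) = 2`:
if `ω > 2` the geometric floor of §1 gives `ρ^k ≤ e(k)` at every `k`, against superexponential contact at
that `ρ`.  (The same statement is the certified, banked one-command re-glue `glue19.lean` of the route.) -/
theorem closes_sldSec (h₁ : SuperExpContact) (h₂ : SummableLogDefect) : _root_.MatrixMultiplication := by
  rw [_root_.MatrixMultiplication_iff]
  refine le_antisymm (not_lt.1 fun hω => ?_) (omega_two_le (K := ℂ))
  obtain ⟨C, hC, hS, hL⟩ := h₂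
  obtain ⟨ρ, hρ, hfloor⟩ := geometric_floor_of_sld hC hS hL hω
  obtain ⟨k, hk, hek⟩ := h₁ ρ hρ
  have := hfloor k (by omega)
  linarith

/-- **DECIDING THEOREM, zero form — cut A‴ (PROVED).**  `FiniteSaturation → SummableLogDefect → ω(ℂ) = 2`
(a far zero is superexponential contact): the node of record with only the generic leaf turned down to the
summable endpoint of the dial. -/
theorem closes_sldFs (h₁ : FiniteSaturation) (h₂ : SummableLogDefect) : _root_.MatrixMultiplication :=
  closes_sldSec (superExpContact_of_finiteSaturation h₁) h₂

/-- **One notch down the dial: `BoundedDoublingDefect (26556) ⟹ SummableLogDefect (27344)`** (the constant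
envelope `C_i := max C 1`; its dyadic series is geometric). -/
theorem sld_of_bdd (hB : BoundedDoublingDefect) : SummableLogDefect := by
  obtain ⟨C, hC⟩ := hB
  have hB' := bdd_mono (le_max_left C 1) hC
  refine ⟨fun _ => max C 1, fun _ => le_max_right _ _, ?_, fun i m hm _ => hB' m hm⟩
  have e : (fun i : ℕ => Real.log (max C 1) / 2 ^ i) = fun i : ℕ => Real.log (max C 1) * (1 / 2) ^ i := by
    funext i
    rw [one_div_pow, div_eq_mul_one_div]
  rw [e]
  exact (summable_geometric_of_lt_one (by norm_num) (by norm_num)).mul_left _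

/-- Two notches: the crux `AnchoredLogConvexity (28900) ⟹ SummableLogDefect (27344)`. -/
theorem sld_of_alc (h : AnchoredLogConvexity) : SummableLogDefect :=
  sld_of_bdd (bdd_of_alc h)

/-- Necessity: `ω = 2 → SummableLogDefect` (tag NEC; via `ω = 2 → BDD`, envelope `1`). -/
theorem sld_of_mm (h : _root_.MatrixMultiplication) : SummableLogDefect :=
  sld_of_bdd (bdd_of_mm h)

/-- **Cut B‴ is exact**: `ω(ℂ) = 2 ⟺ SuperExpContact ∧ SummableLogDefect` — both leaves strictly weaker
than those of the node of record (special: gen 17; generic: gens 18–19). -/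
theorem node_sldSec_iff : _root_.MatrixMultiplication ↔ SuperExpContact ∧ SummableLogDefect :=
  ⟨fun h => ⟨superExpContact_of_mm h, sld_of_mm h⟩, fun h => closes_sldSec h.1 h.2⟩

/-- **Cut A‴ is exact**: `ω(ℂ) = 2 ⟺ FiniteSaturation ∧ SummableLogDefect`. -/
theorem node_sldFs_iff : _root_.MatrixMultiplication ↔ FiniteSaturation ∧ SummableLogDefect :=
  ⟨fun h => ⟨finiteSaturation_of_mm h, sld_of_mm h⟩, fun h => closes_sldFs h.1 h.2⟩

/-- **The dial, four notches (PROVED chain):** `RealLogConvexity (28902) ⟹ AnchoredLogConvexity (28900) ⟹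
BoundedDoublingDefect (26556) ⟹ SummableLogDefect (27344) ⟹ (SuperExpContact (28901) → ω = 2)`. -/
theorem dial_chain₄ :
    (RealLogConvexity → AnchoredLogConvexity) ∧ (AnchoredLogConvexity → BoundedDoublingDefect) ∧
      (BoundedDoublingDefect → SummableLogDefect) ∧
        (SummableLogDefect → SuperExpContact → _root_.MatrixMultiplication) :=
  ⟨anchored_of_realLogConvexity, bdd_of_alc, sld_of_bdd, fun hS h₁ => closes_sldSec h₁ hS⟩

end Summit.MatrixMultiplication.MatrixMultiplication.Theorems.FarEdgeDescentSummableDefect
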